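import Summits.QuantumFields.YangMills.Theorems.UnitScaleTiltProp8ChartDeriv
import Summits.QuantumFields.YangMills.Theorems.UnitScaleTiltProp7CombGauge
import HarnessLib

/-!
# Route `UnitScaleTilt`, crux K1 «MinimiserStabilityRegPr» (stmt-QuantumFields-19200), leaf V2′ — the P2→P3 BRIDGE (hH of `ChartRemainderAt`),
# part A: **THE HIERARCHICAL COMB FUNCTIONAL `Λ_j` AND THE ALGEBRA OF THE TRUE LINEARISATION `Q^{(j)} = L^j·Q_j − dΛ_j`**

Cell `ym3-torus`, seat `ym3-torus-p1` g18.  The third conjunct (hH) of the P3 text `Prop8Chart.ChartRemainderAt` (p539223) asks for a right inverse of the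
TRUE linearised multi-level (0.4)-constraint `fderiv ℂ (chartLog η D) 0 = η·Q^{(j)}` (p544829), while P2's flat operator `H` (157) inverts the STRAIGHT
averages `Q_j` ([Balaban1984PropagatorsI] (1.18)); the two differ by the coarse pure gauge `dΛ_j` (p522364).  This file fixes the hierarchical comb functional
`Λ_j` by its recursion `Λ₀ = 0`, `Λ_{j+1}(Y)(y) = L^j·λ̄(Q_jY)(y) + Λ_j(Y)(emb y)` (`λ̄ = combMean`, [Balaban1985Averaging] (62)) and records its algebra:
the identity `Q^{(j)}Y = L^j·Q_jY − dΛ_j(Y)` for a `Q^{(j)}`-family characterised by `Q^{(0)} = id`, `Q^{(j+1)} = linAvg ∘ Q^{(j)}`; additivity and homogeneity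
(complex scalars) of `Q^{(j)}`, `λ̄`, `Λ_j`, `Q_j`; the pure-gauge rule `Q^{(j)}(dφ) = d(φ∘embIter j)`; `Q_j` commutes with every real-linear map of the
coefficients; and the locality of `λ̄` (it reads only the bonds of the staircases of (0.3) issued from the block centre).  Definition-light: `Λ_j` is a
hypothesis-characterised family (`exists_combFamily`), nothing of Bałaban's is asserted.  NOT a claim about the mass gap.

References: T. Bałaban, CMP **102** (1985) 277–309 [Balaban1985Variational] ((45)–(46) p.285, (156)–(157) p.302); CMP **98** (1985) 17–51
[Balaban1985Averaging] ((62) p.28, (124)–(125) p.36); CMP **95** (1984) 17–40 [Balaban1984PropagatorsI] ((1.11) p.19, (1.18) p.20).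
-/

noncomputable section

open scoped BigOperators

namespace Summit.QuantumFields.YangMills.Theorems.ChartHInv

open Literature.MathematicalPhysics.QuantumFieldTheory.Balaban1983to89
open T4Continuum BlockAveraging BlockAveragingEMLLinearised LatticeFieldCalculus
open B15DeterminingSets (embIter)
open Summit.QuantumFields.YangMills.Theorems.Prop7LinAvgOnto (linAvg_add)
open Summit.QuantumFields.YangMills.Theorems.Prop8Chart (linAvg_const_smul walkSum_const_smul)
open Summit.QuantumFields.YangMills.Theorems.Prop7CombGauge (walkSum_add combMean_add)

variable {P : Params} {n : Type*}

/-! ## §1 The comb mean: homogeneity, locality -/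

/-- The comb mean `λ̄` of [Balaban1985Averaging] (62) commutes with complex scalars. [cite: Balaban1985Averaging, (62) p.28] -/
theorem combMean_const_smul {j : ℕ} (a : ℂ) (Y : PBond P j → Matrix n n ℂ) (y : Site P (j + 1)) :
    combMean (fun b => a • Y b) y = a • combMean Y y := by
  rw [combMean_def, combMean_def]
  simp only [walkSum_const_smul, ← Finset.smul_sum]
  rw [smul_comm]

/-- The comb mean commutes with real scalars. [cite: Balaban1985Averaging, (62) p.28] -/
theorem combMean_real_smul {j : ℕ} (r : ℝ) (Y : PBond P j → Matrix n n ℂ) (y : Site P (j + 1)) :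
    combMean (fun b => r • Y b) y = r • combMean Y y := by
  have h := combMean_const_smul (P := P) (n := n) (r : ℂ) Y y
  simp only [Complex.coe_smul] at h
  exact h

/-- The comb mean of a difference. [cite: Balaban1985Averaging, (62) p.28] -/
theorem combMean_sub {j : ℕ} (Y Z : PBond P j → Matrix n n ℂ) (y : Site P (j + 1)) :
    combMean (fun b => Y b - Z b) y = combMean Y y - combMean Z y := by
  have h := combMean_add (fun b => Y b - Z b) Z y
  simp only [sub_add_cancel] at h
  rw [h, add_sub_cancel_right]

/-- The comb mean of the zero field vanishes. [cite: Balaban1985Averaging, (62) p.28] -/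
theorem combMean_zero {j : ℕ} (y : Site P (j + 1)) : combMean (fun _ : PBond P j => (0 : Matrix n n ℂ)) y = 0 := by
  have h := combMean_const_smul (P := P) (n := n) (0 : ℂ) (fun _ : PBond P j => (0 : Matrix n n ℂ)) y
  simp only [smul_zero, zero_smul] at h
  exact h

/-- **LOCALITY OF THE COMB MEAN**: `λ̄_Y(y)` reads `Y` only on the bonds of the staircases of (0.3) issued from the centre `emb y` — two fields agreeing on
those bonds have the same comb mean at `y`. [cite: Balaban1985Averaging, (62) p.28; Balaban1987RG1, (0.3) p.252] -/
theorem combMean_congr_stairs {j : ℕ} {Y Y' : PBond P j → Matrix n n ℂ} (y : Site P (j + 1))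
    (h : ∀ (σ : Equiv.Perm (Fin P.d)) (r : Fin P.d → Fin P.L), ∀ s ∈ walk (emb y) (stairWord σ (off r)), Y s.bond = Y' s.bond) :
    combMean Y y = combMean Y' y := by
  rw [combMean_def, combMean_def]
  congr 1
  refine Finset.sum_congr rfl fun i _ => ?_
  have hsum : ∀ γ : List (LStep P j), (∀ s ∈ γ, Y s.bond = Y' s.bond) → walkSum Y γ = walkSum Y' γ := by
    intro γ
    induction γ with
    | nil => intro _; simp [walkSum_nil]
    | cons s γ ih =>
      intro hγ
      rw [walkSum_cons, walkSum_cons, ih fun s' hs' => hγ s' (List.mem_cons_of_mem _ hs'), hγ s List.mem_cons_self]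
  exact hsum _ (h i.2.1 i.1)

/-! ## §2 The straight averages commute with real-linear maps of the coefficients -/

section Natural

variable {V W : Type*} [AddCommGroup V] [Module ℝ V] [AddCommGroup W] [Module ℝ W]

/-- `Q` ([Balaban1984PropagatorsI] (1.11)) commutes with every real-linear map of the coefficients (`Q` is a real-linear combination of values).
[cite: Balaban1984PropagatorsI, (1.11) p.19] -/
theorem bondAvg_comp_apply {j : ℕ} (φ : V →ₗ[ℝ] W) (A : VecField P j V) (c : PBond P (j + 1)) :
    bondAvg (fun b => φ (A b)) c = φ (bondAvg A c) := by
  unfold bondAvg segSum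
  rw [map_smul, map_sum]
  congr 1
  refine Finset.sum_congr rfl fun r _ => ?_
  rw [map_sum]

/-- `Q_k` ([Balaban1984PropagatorsI] (1.18)) commutes with every real-linear map of the coefficients. [cite: Balaban1984PropagatorsI, (1.18) p.20] -/
theorem bondAvgIter_comp_apply (φ : V →ₗ[ℝ] W) : ∀ (k : ℕ) (A : VecField P 0 V) (c : PBond P k),
    bondAvgIter k (fun b => φ (A b)) c = φ (bondAvgIter k A c)
  | 0, _, _ => rfl
  | k + 1, A, c => by
    show bondAvg (bondAvgIter k (fun b => φ (A b))) c = φ (bondAvg (bondAvgIter k A) c)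
    rw [show bondAvgIter k (fun b => φ (A b)) = fun b => φ (bondAvgIter k A b) from funext (bondAvgIter_comp_apply φ k A),
      bondAvg_comp_apply]

end Natural

/-- `Q_k` commutes with complex scalars on matrix-valued fields. [cite: Balaban1984PropagatorsI, (1.18) p.20] -/
theorem bondAvgIter_const_smul (a : ℂ) (k : ℕ) (A : PBond P 0 → Matrix n n ℂ) (c : PBond P k) :
    bondAvgIter k (fun b => a • A b) c = a • bondAvgIter k A c :=
  bondAvgIter_comp_apply ((LinearMap.lsmul ℂ (Matrix n n ℂ) a).restrictScalars ℝ) k A c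

/-- `Q_k` applied to a real kernel against fixed matrices: `Q_k(b ↦ Σ_i K(b,i)·Z_i)(c) = Σ_i (Q_kK(·,i))(c)·Z_i`. [cite: Balaban1984PropagatorsI, (1.18) p.20] -/
theorem bondAvgIter_kernel_apply {ι : Type*} [Fintype ι] (K : PBond P 0 → ι → ℝ) (Z : ι → Matrix n n ℂ) (k : ℕ) (c : PBond P k) :
    bondAvgIter k (fun b => ∑ i, K b i • Z i) c = ∑ i, bondAvgIter k (fun b => K b i) c • Z i := by
  classical
  -- the real-linear map `K ↦ Σ_i K_i • Z_i` from `ι → ℝ`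
  let φ : (ι → ℝ) →ₗ[ℝ] Matrix n n ℂ :=
    { toFun := fun v => ∑ i, v i • Z i
      map_add' := fun v v' => by simp only [Pi.add_apply, add_smul, Finset.sum_add_distrib]
      map_smul' := fun r v => by simp only [Pi.smul_apply, smul_eq_mul, mul_smul, Finset.smul_sum, RingHom.id_apply] }
  have h := bondAvgIter_comp_apply φ k (fun b => K b) c
  simp only [φ, LinearMap.coe_mk, AddHom.coe_mk] at h
  rw [h]
  -- `Q_k` of the vector-valued field `b ↦ K b` evaluates componentwise
  congr 1
  funext i
  congr 1
  exact (bondAvgIter_comp_apply (LinearMap.proj i : (ι → ℝ) →ₗ[ℝ] ℝ) k (fun b => K b) c).symm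

/-! ## §3 The `Q^{(j)}`-family and the comb functional `Λ_j` (hypothesis-characterised) -/

section Families

variable (Q : (i : ℕ) → (PBond P 0 → Matrix n n ℂ) → PBond P i → Matrix n n ℂ)
  (hQ0 : ∀ Y, Q 0 Y = Y) (hQs : ∀ (i : ℕ) (Y : PBond P 0 → Matrix n n ℂ) (c : PBond P (i + 1)), Q (i + 1) Y c = linAvg (Q i Y) c)
  (Λ : (i : ℕ) → (PBond P 0 → Matrix n n ℂ) → Site P i → Matrix n n ℂ)
  (hΛ0 : ∀ Y y, Λ 0 Y y = 0)
  (hΛs : ∀ (i : ℕ) (Y : PBond P 0 → Matrix n n ℂ) (y : Site P (i + 1)), Λ (i + 1) Y y = (P.L ^ i : ℕ) • combMean (bondAvgIter i Y) y + Λ i Y (emb y))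

/-- **A `Q^{(j)}`-FAMILY EXISTS** (`Q^{(0)} = id`, `Q^{(j+1)} = linAvg ∘ Q^{(j)}`). [cite: Balaban1985Averaging, (124)-(125) p.36] -/
theorem exists_linFamily : ∃ Q : (i : ℕ) → (PBond P 0 → Matrix n n ℂ) → PBond P i → Matrix n n ℂ,
    (∀ Y, Q 0 Y = Y) ∧ ∀ (i : ℕ) (Y : PBond P 0 → Matrix n n ℂ) (c : PBond P (i + 1)), Q (i + 1) Y c = linAvg (Q i Y) c :=
  ⟨fun i => Nat.rec (motive := fun i => (PBond P 0 → Matrix n n ℂ) → PBond P i → Matrix n n ℂ) (fun Y => Y)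
      (fun _ Qi Y c => linAvg (Qi Y) c) i, fun _ => rfl, fun _ _ _ => rfl⟩

/-- **THE HIERARCHICAL COMB FUNCTIONAL EXISTS** (`Λ₀ = 0`, `Λ_{j+1}(Y)(y) = L^j·λ̄(Q_jY)(y) + Λ_j(Y)(emb y)`). [cite: Balaban1985Averaging, (62) p.28] -/
theorem exists_combFamily : ∃ Λ : (i : ℕ) → (PBond P 0 → Matrix n n ℂ) → Site P i → Matrix n n ℂ,
    (∀ Y y, Λ 0 Y y = 0) ∧
      ∀ (i : ℕ) (Y : PBond P 0 → Matrix n n ℂ) (y : Site P (i + 1)), Λ (i + 1) Y y = (P.L ^ i : ℕ) • combMean (bondAvgIter i Y) y + Λ i Y (emb y) :=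
  ⟨fun i => Nat.rec (motive := fun i => (PBond P 0 → Matrix n n ℂ) → Site P i → Matrix n n ℂ) (fun _ _ => 0)
      (fun i Λi Y y => (P.L ^ i : ℕ) • combMean (bondAvgIter i Y) y + Λi Y (emb y)) i, fun _ _ => rfl, fun _ _ _ => rfl⟩

include hQ0 hQs in
/-- `Q^{(j)}` is additive. [cite: Balaban1985Averaging, (124)-(125) p.36] -/
theorem linFamily_add : ∀ (k : ℕ) (Y Y' : PBond P 0 → Matrix n n ℂ) (c : PBond P k),
    Q k (fun b => Y b + Y' b) c = Q k Y c + Q k Y' c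
  | 0, Y, Y', c => by rw [hQ0, hQ0, hQ0]
  | k + 1, Y, Y', c => by
    rw [hQs, hQs, hQs, show Q k (fun b => Y b + Y' b) = fun b => Q k Y b + Q k Y' b from funext (linFamily_add k Y Y'), linAvg_add]

include hQ0 hQs in
/-- `Q^{(j)}` commutes with complex scalars. [cite: Balaban1985Averaging, (124)-(125) p.36] -/
theorem linFamily_const_smul (a : ℂ) : ∀ (k : ℕ) (Y : PBond P 0 → Matrix n n ℂ) (c : PBond P k),
    Q k (fun b => a • Y b) c = a • Q k Y c
  | 0, Y, c => by rw [hQ0, hQ0]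
  | k + 1, Y, c => by
    rw [hQs, hQs, show Q k (fun b => a • Y b) = fun b => a • Q k Y b from funext (linFamily_const_smul a k Y), linAvg_const_smul]

include hQ0 hQs in
/-- **THE TRUE LINEARISATION ON A FINE PURE GAUGE** `(dφ)_b = φ(b₊) − φ(b₋)` is the coarse pure gauge of `φ` at the `j`-fold centres:
`Q^{(j)}(dφ)(c) = φ(embIter j c₊) − φ(embIter j c₋)`. [cite: Balaban1985Averaging, (11) p.19] -/
theorem linFamily_grad (φ : Site P 0 → Matrix n n ℂ) (k : ℕ) (c : PBond P k) :
    Q k (fun b => φ b.tgt - φ b.src) c = φ (embIter k c.tgt) - φ (embIter k c.src) :=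
  Prop7AvgLinearisation.iterLin_grad Q hQ0 hQs (fun i φ y => φ (embIter i y)) (fun _ => rfl) (fun _ _ _ => rfl) φ k c

include hQ0 hQs hΛ0 hΛs in
/-- **`Q^{(j)}Y = L^j·Q_jY − dΛ_j(Y)`**: the true linearised `j`-fold (0.4)-constraint is print's `L^j·Q_j` minus the coarse pure gauge of the hierarchical comb
functional (p522364's `exists_iterLin_eq_bondAvgIter_sub_grad` with the witness made explicit). [cite: Balaban1984PropagatorsI, (1.18) p.20; Balaban1985Averaging, (124)-(125) p.36] -/
theorem linFamily_eq_sub_comb (Y : PBond P 0 → Matrix n n ℂ) : ∀ (k : ℕ) (c : PBond P k),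
    Q k Y c = (P.L ^ k : ℕ) • bondAvgIter k Y c - (Λ k Y c.tgt - Λ k Y c.src)
  | 0, c => by
    rw [hQ0, hΛ0, hΛ0, pow_zero, one_smul, sub_self, sub_zero]
    rfl
  | k + 1, c => by
    have hfun : Q k Y = fun b : PBond P k => (P.L ^ k : ℕ) • bondAvgIter k Y b - (Λ k Y b.tgt - Λ k Y b.src) :=
      funext (linFamily_eq_sub_comb Y k)
    rw [hQs, hfun, Prop7AvgLinearisation.linAvg_sub (fun b : PBond P k => (P.L ^ k : ℕ) • bondAvgIter k Y b) (fun b => Λ k Y b.tgt - Λ k Y b.src) c,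
      Prop7AvgLinearisation.linAvg_nsmul, linAvg_grad, linAvg_eq_bondAvg_sub_grad_combMean, hΛs, hΛs]
    have hiter : bondAvgIter (k + 1) Y = bondAvg (bondAvgIter k Y) := rfl
    rw [hiter, pow_succ, mul_smul, Nat.cast_smul_eq_nsmul ℂ, smul_sub, smul_sub]
    simp only [sub_eq_add_neg, neg_add, neg_neg]
    abel

include hΛ0 hΛs in
/-- `Λ_j` is additive. [cite: Balaban1985Averaging, (62) p.28] -/
theorem combFamily_add : ∀ (k : ℕ) (Y Y' : PBond P 0 → Matrix n n ℂ) (y : Site P k),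
    Λ k (fun b => Y b + Y' b) y = Λ k Y y + Λ k Y' y
  | 0, Y, Y', y => by rw [hΛ0, hΛ0, hΛ0, add_zero]
  | k + 1, Y, Y', y => by
    rw [hΛs, hΛs, hΛs, combFamily_add k Y Y' (emb y)]
    have hQ : bondAvgIter k (fun b => Y b + Y' b) = fun b => bondAvgIter k Y b + bondAvgIter k Y' b := by
      have := Literature.MathematicalPhysics.QuantumFieldTheory.BalabanImbrieJaffe1984to88.BIJ85AxialPropagator411.bondAvgIter_add (P := P) k Y Y'
      exact this
    rw [hQ, combMean_add, smul_add]
    abel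

include hΛ0 hΛs in
/-- `Λ_j` commutes with complex scalars. [cite: Balaban1985Averaging, (62) p.28] -/
theorem combFamily_const_smul (a : ℂ) : ∀ (k : ℕ) (Y : PBond P 0 → Matrix n n ℂ) (y : Site P k),
    Λ k (fun b => a • Y b) y = a • Λ k Y y
  | 0, Y, y => by rw [hΛ0, hΛ0, smul_zero]
  | k + 1, Y, y => by
    rw [hΛs, hΛs, combFamily_const_smul a k Y (emb y)]
    have hQ : bondAvgIter k (fun b => a • Y b) = fun b => a • bondAvgIter k Y b := funext (bondAvgIter_const_smul a k Y)
    rw [hQ, combMean_const_smul, smul_add, smul_comm]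

end Families

end Summit.QuantumFields.YangMills.Theorems.ChartHInv

end
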